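import Summits.Ventures.Crystal3D.Bulk.GapDegrees
import Summits.Ventures.Crystal3D.Bulk.GapAzimuths
import HarnessLib

/-!
# Sharper degree bounds in the GAP census window: total tight degree `≤ 5` at a shell ball
# (intruder included) and intruder degree `≤ 4` (P-L2(b),(c))

HONEST FRAMING. Part of the venture `Summits/Ventures/Crystal3D` (cell `pub-crystal3d`, phase 2,
24-hour sprint `PLAN.md` R42; seat typer-bulk-2). `Bulk/GapDegrees.lean` bounds the number of
SHELL contacts of a shell ball and of the intruder by five (Musin–Tarasov 2012 Prop. 3.3 at one
contact level). The census (`DESIGN-L12-THEORY.md` P-L2(b),(c)) uses two sharper facts, valid on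
the census WINDOW of intruder distances `D = intruderDist c`, for EVERY admissible configuration
(`IsGapConfig`; no extremality), obtained from the two-level azimuth engine `Bulk/GapAzimuths.lean`:

* `IsGapConfig.card_tight_le_five`: for `D² < 12/7` (`D < 1.3093`, hole radius `> 49.1°`) a shell
  ball has at most FIVE tight partners IN TOTAL, the intruder counted (P-L2(b)): around
  `v = c i − c 0` the tight shell partners sit at level `1/2`, the intruder at level `D/2`;
  shell–shell tangent angles have cosine `≤ 1/3`, shell–intruder ones `≤ D/(√3 √(4 − D²)) < 1/2`;
* `IsGapConfig.card_intruderContacts_le_four`: for `2(5 − √5)/5 < D² < 4` (`D > 1.05146`, hole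
  radius `< 58.2825°`) the intruder touches at most FOUR shell balls (P-L2(c)): the touching
  shell centres sit at level `D/2` around the intruder's direction, pairwise at inner product
  `≤ 1/2`, so their azimuth differences have cosine `≤ (1/2 − D²/4)/(1 − D²/4) < cos(2π/5)`;
  decimal instance `IsGapConfig.card_intruderContacts_le_four_of_le` for `1.0515 ≤ D < 2`.

Together with `Bulk/GapTightDegree.lean` (`≥ 3` on both counts at (reduced) extremal
configurations) the census degrees on the window are `{0, 3, 4, 5}` at shell balls (intruder
counted) and `{3, 4}` at the intruder. Nothing claimed about GAP(1.26).
-/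

noncomputable section

open scoped BigOperators InnerProductSpace
open Finset Real

namespace Summit.Ventures.Crystal3D

open Literature.Geometry.DiscreteGeometry

/-! ## The configuration around a shell ball: directions and levels -/

variable {c : Fin 14 → EuclideanSpace ℝ (Fin 3)}

/-- The unit direction of ball `j` seen from ball `0`. For a shell ball it is `c j − c 0` itself. -/
theorem IsGapConfig.norm_dir (hc : IsGapConfig c) {j : Fin 14} (hj0 : j ≠ 0) :
    ‖‖c j - c 0‖⁻¹ • (c j - c 0)‖ = 1 := by
  have hne : c j - c 0 ≠ 0 := sub_ne_zero.2 fun h => hj0 (hc.injective h)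
  rw [norm_smul, norm_inv, norm_norm, inv_mul_cancel₀ (norm_ne_zero_iff.2 hne)]

/-- For a shell ball the direction is `c j − c 0`. -/
theorem IsGapConfig.dir_eq_of_shell (hc : IsGapConfig c) {j : Fin 14} (hj0 : j ≠ 0)
    (hj13 : j ≠ 13) : ‖c j - c 0‖⁻¹ • (c j - c 0) = c j - c 0 := by
  rw [hc.norm_sub_eq_one hj0 hj13, inv_one, one_smul]

/-- The intruder's offset is `D •` its direction, `D = intruderDist c`. -/
theorem IsGapConfig.sub_eq_intruderDist_smul (hc : IsGapConfig c) :
    c 13 - c 0 = intruderDist c • (‖c 13 - c 0‖⁻¹ • (c 13 - c 0)) := by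
  have hD : ‖c 13 - c 0‖ = intruderDist c := by rw [← dist_eq_norm, dist_comm]; rfl
  have hpos : 0 < intruderDist c := by linarith [hc.one_le_intruderDist]
  rw [smul_smul, hD, mul_inv_cancel₀ hpos.ne', one_smul]

/-- **Level of an intruder contact.** If shell ball `i` touches the intruder then, seen from
ball `0`, the intruder's direction is at inner product `D/2` with `c i − c 0`. -/
theorem IsGapConfig.inner_dir_intruder_of_touch (hc : IsGapConfig c) {i : Fin 14} (hi0 : i ≠ 0)
    (hi13 : i ≠ 13) (hd : dist (c i) (c 13) = 1) :
    ⟪c i - c 0, ‖c 13 - c 0‖⁻¹ • (c 13 - c 0)⟫_ℝ = intruderDist c / 2 := by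
  set p := ‖c 13 - c 0‖⁻¹ • (c 13 - c 0) with hpdef
  have hp : ‖p‖ = 1 := hc.norm_dir (by decide)
  have h13 := hc.sub_eq_intruderDist_smul
  rw [← hpdef] at h13
  set D := intruderDist c with hDdef
  have hpos : 0 < D := by linarith [hc.one_le_intruderDist]
  have hu := hc.norm_sub_eq_one hi0 hi13
  have hsq : dist (c i - c 0) (c 13 - c 0) ^ 2 = 1 - 2 * D * ⟪c i - c 0, p⟫_ℝ + D ^ 2 := by
    rw [h13, dist_eq_norm, norm_sub_sq_real, norm_smul, Real.norm_of_nonneg hpos.le, hp, hu,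
      real_inner_smul_right]
    ring
  rw [dist_sub_right, hd] at hsq
  have : 2 * D * ⟪c i - c 0, p⟫_ℝ = D * D := by nlinarith [hsq]
  field_simp
  nlinarith [this, hpos]

/-- **Separation from the intruder.** Every shell ball `j` is at distance `≥ 1` from the
intruder, so the intruder's direction has inner product `≤ D/2` with `c j − c 0`. -/
theorem IsGapConfig.inner_dir_intruder_le (hc : IsGapConfig c) {j : Fin 14} (hj0 : j ≠ 0)
    (hj13 : j ≠ 13) :
    ⟪c j - c 0, ‖c 13 - c 0‖⁻¹ • (c 13 - c 0)⟫_ℝ ≤ intruderDist c / 2 := by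
  set p := ‖c 13 - c 0‖⁻¹ • (c 13 - c 0) with hpdef
  have hp : ‖p‖ = 1 := hc.norm_dir (by decide)
  have h13 := hc.sub_eq_intruderDist_smul
  rw [← hpdef] at h13
  set D := intruderDist c with hDdef
  have hpos : 0 < D := by linarith [hc.one_le_intruderDist]
  have hu := hc.norm_sub_eq_one hj0 hj13
  have hsq : dist (c j - c 0) (c 13 - c 0) ^ 2 = 1 - 2 * D * ⟪c j - c 0, p⟫_ℝ + D ^ 2 := by
    rw [h13, dist_eq_norm, norm_sub_sq_real, norm_smul, Real.norm_of_nonneg hpos.le, hp, hu,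
      real_inner_smul_right]
    ring
  have h1 : 1 ≤ dist (c j - c 0) (c 13 - c 0) := by rw [dist_sub_right]; exact hc.1 j 13 hj13
  have h2 : 1 ≤ dist (c j - c 0) (c 13 - c 0) ^ 2 := by nlinarith [h1]
  rw [hsq] at h2
  nlinarith [h2, hpos]

/-! ## Total tight degree `≤ 5` at a shell ball (intruder included) -/

/-- The two-level separation inequality behind P-L2(b): for `D² < 12/7`,
`D/4 < (1/2) · √(1 − (1/2)²) · √(1 − (D/2)²)`. -/
theorem quarter_lt_half_sqrt_mul_sqrt {D : ℝ} (hD0 : 0 ≤ D) (hD : D ^ 2 < 12 / 7) :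
    D / 4 < 1 / 2 * (√(1 - (1 / 2 : ℝ) ^ 2) * √(1 - (D / 2) ^ 2)) := by
  have h34 : √(1 - (1 / 2 : ℝ) ^ 2) * √(1 - (D / 2) ^ 2) = √((1 - (1 / 2 : ℝ) ^ 2) * (1 - (D / 2) ^ 2)) :=
    (Real.sqrt_mul (by norm_num) _).symm
  rw [h34]
  have hlt : D / 2 < √((1 - (1 / 2 : ℝ) ^ 2) * (1 - (D / 2) ^ 2)) := by
    rw [Real.lt_sqrt (by linarith)]
    nlinarith [hD]
  linarith

/-- **A shell ball has at most five tight partners in total, the intruder counted** (P-L2(b);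
every admissible configuration with `intruderDist² < 12/7`, i.e. `D < 1.3093`, hole radius
`> 49.1°` — the whole census window). Around `v = c i − c 0` the tight shell partners sit at
level `1/2`, the intruder (if tight) at level `D/2`; shell–shell tangent angles have cosine
`≤ 1/3 < 1/2`, shell–intruder ones `≤ D/(√3 √(4 − D²)) < 1/2`, so six of them do not fit. -/
theorem IsGapConfig.card_tight_le_five (hc : IsGapConfig c) {i : Fin 14} (hi0 : i ≠ 0)
    (hi13 : i ≠ 13) (hD : intruderDist c ^ 2 < 12 / 7) :
    (univ.filter fun j : Fin 14 => j ≠ 0 ∧ j ≠ i ∧ dist (c i) (c j) = 1).card ≤ 5 := by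
  classical
  set T := univ.filter fun j : Fin 14 => j ≠ 0 ∧ j ≠ i ∧ dist (c i) (c j) = 1 with hT
  by_contra h
  obtain ⟨N', hN', hcard⟩ := exists_subset_card_eq (show 6 ≤ T.card by omega)
  set e := (equivFinOfCardEq hcard).symm with he
  -- data of the six partners
  have hmemT : ∀ k, ((e k : Fin 14)) ∈ T := fun k => hN' (e k).2
  have hk0 : ∀ k, (e k : Fin 14) ≠ 0 := fun k => ((mem_filter.1 (hmemT k)).2).1
  have hki : ∀ k, (e k : Fin 14) ≠ i := fun k => ((mem_filter.1 (hmemT k)).2).2.1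
  have hkd : ∀ k, dist (c i) (c (e k)) = 1 := fun k => ((mem_filter.1 (hmemT k)).2).2.2
  have hinj : ∀ k l, k ≠ l → (e k : Fin 14) ≠ (e l : Fin 14) := fun k l hkl h =>
    hkl (e.injective (Subtype.val_injective h))
  set v := c i - c 0 with hvdef
  have hv : ‖v‖ = 1 := hc.norm_sub_eq_one hi0 hi13
  set D := intruderDist c with hDdef
  have hD1 : 1 ≤ D := hc.one_le_intruderDist
  have hD2 : D < 2 := by nlinarith [hD]
  -- directions
  set u : Fin 6 → EuclideanSpace ℝ (Fin 3) := fun k => ‖c (e k) - c 0‖⁻¹ • (c (e k) - c 0)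
    with hudef
  have hn : ∀ k, ‖u k‖ = 1 := fun k => hc.norm_dir (hk0 k)
  -- levels: `1/2` for a shell partner, `D/2` for the intruder
  have hlev_shell : ∀ k, (e k : Fin 14) ≠ 13 → ⟪v, u k⟫_ℝ = 1 / 2 := by
    intro k hk13
    show ⟪c i - c 0, ‖c (e k) - c 0‖⁻¹ • (c (e k) - c 0)⟫_ℝ = 1 / 2
    rw [hc.dir_eq_of_shell (hk0 k) hk13]
    exact hc.inner_sub_eq_half hi0 hi13 (hk0 k) hk13 (hkd k)
  have hlev_intr : ∀ k, (e k : Fin 14) = 13 → ⟪v, u k⟫_ℝ = D / 2 := by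
    intro k hk13
    show ⟪c i - c 0, ‖c (e k) - c 0‖⁻¹ • (c (e k) - c 0)⟫_ℝ = D / 2
    rw [hk13]
    have hd : dist (c i) (c 13) = 1 := by rw [← hk13]; exact hkd k
    exact hc.inner_dir_intruder_of_touch hi0 hi13 hd
  have hlev : ∀ k, ⟪v, u k⟫_ℝ ^ 2 < 1 := by
    intro k
    by_cases hk13 : (e k : Fin 14) = 13
    · rw [hlev_intr k hk13]; nlinarith [hD2, hD1]
    · rw [hlev_shell k hk13]; norm_num
  refine no_six_directions hv u hn hlev ?_
  intro k l hkl
  have hne := hinj k l hkl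
  by_cases hk13 : (e k : Fin 14) = 13
  · -- intruder vs shell partner
    have hl13 : (e l : Fin 14) ≠ 13 := fun h => hne (hk13.trans h.symm)
    rw [hlev_intr k hk13, hlev_shell l hl13]
    have hin : ⟪u k, u l⟫_ℝ ≤ D / 2 := by
      show ⟪‖c (e k) - c 0‖⁻¹ • (c (e k) - c 0), ‖c (e l) - c 0‖⁻¹ • (c (e l) - c 0)⟫_ℝ ≤ D / 2
      rw [hc.dir_eq_of_shell (hk0 l) hl13, hk13, real_inner_comm]
      exact hc.inner_dir_intruder_le (hk0 l) hl13
    have key := quarter_lt_half_sqrt_mul_sqrt (by linarith) hD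
    rw [mul_comm (√(1 - (1 / 2 : ℝ) ^ 2))] at key
    linarith
  · by_cases hl13 : (e l : Fin 14) = 13
    · -- shell partner vs intruder
      rw [hlev_shell k hk13, hlev_intr l hl13]
      have hin : ⟪u k, u l⟫_ℝ ≤ D / 2 := by
        show ⟪‖c (e k) - c 0‖⁻¹ • (c (e k) - c 0), ‖c (e l) - c 0‖⁻¹ • (c (e l) - c 0)⟫_ℝ ≤ D / 2
        rw [hc.dir_eq_of_shell (hk0 k) hk13, hl13]
        exact hc.inner_dir_intruder_le (hk0 k) hk13
      have key := quarter_lt_half_sqrt_mul_sqrt (by linarith) hD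
      linarith
    · -- two shell partners
      rw [hlev_shell k hk13, hlev_shell l hl13]
      have hin : ⟪u k, u l⟫_ℝ ≤ 1 / 2 := by
        show ⟪‖c (e k) - c 0‖⁻¹ • (c (e k) - c 0), ‖c (e l) - c 0‖⁻¹ • (c (e l) - c 0)⟫_ℝ ≤ 1 / 2
        rw [hc.dir_eq_of_shell (hk0 k) hk13, hc.dir_eq_of_shell (hk0 l) hl13]
        exact hc.inner_sub_le_half (hk0 k) hk13 (hk0 l) hl13 hne
      have h34 : √(1 - (1 / 2 : ℝ) ^ 2) * √(1 - (1 / 2 : ℝ) ^ 2) = 3 / 4 := by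
        rw [Real.mul_self_sqrt (by norm_num)]; norm_num
      rw [h34]
      linarith

/-! ## Intruder degree `≤ 4` below hole radius `58.2825°` -/

/-- The one-level separation inequality behind P-L2(c): for `(5 − √5)/10 < κ² < 1`,
`1/2 − κ² < cos(2π/5) (1 − κ²)`. -/
theorem half_sub_sq_lt_cos_mul {κ : ℝ} (hκ : (5 - √5) / 10 < κ ^ 2) :
    1 / 2 - κ ^ 2 < Real.cos (2 * π / 5) * (√(1 - κ ^ 2) * √(1 - κ ^ 2)) ∨ 1 ≤ κ ^ 2 := by
  by_cases h1 : 1 ≤ κ ^ 2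
  · exact Or.inr h1
  left
  push Not at h1
  rw [Real.mul_self_sqrt (by linarith), cos_two_pi_div_five]
  have h5 : √5 * √5 = 5 := Real.mul_self_sqrt (by norm_num)
  have hs3 : √5 < 3 := by nlinarith [h5, Real.sqrt_nonneg 5]
  nlinarith [h5, hs3, mul_pos (show (0:ℝ) < 5 - √5 by linarith) (show (0:ℝ) < 1 - κ ^ 2 by linarith)]

/-- **The intruder touches at most four shell balls when `2(5 − √5)/5 < intruderDist² < 4`**
(P-L2(c): hole radius `< 58.2825°`; every admissible configuration). The touching shell
centres sit at level `κ = D/2` around the intruder's direction and are pairwise at inner product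
`≤ 1/2`, so their pairwise azimuth differences have cosine `≤ (1/2 − κ²)/(1 − κ²) < cos(2π/5)`,
and five of them do not fit around a circle. -/
theorem IsGapConfig.card_intruderContacts_le_four (hc : IsGapConfig c)
    (hDlo : 2 * (5 - √5) / 5 < intruderDist c ^ 2) (hD2 : intruderDist c < 2) :
    (univ.filter fun j : Fin 14 => j ≠ 0 ∧ j ≠ 13 ∧ dist (c 13) (c j) = 1).card ≤ 4 := by
  classical
  set T := univ.filter fun j : Fin 14 => j ≠ 0 ∧ j ≠ 13 ∧ dist (c 13) (c j) = 1 with hT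
  by_contra h
  obtain ⟨N', hN', hcard⟩ := exists_subset_card_eq (show 5 ≤ T.card by omega)
  set e := (equivFinOfCardEq hcard).symm with he
  have hmemT : ∀ k, ((e k : Fin 14)) ∈ T := fun k => hN' (e k).2
  have hk0 : ∀ k, (e k : Fin 14) ≠ 0 := fun k => ((mem_filter.1 (hmemT k)).2).1
  have hk13 : ∀ k, (e k : Fin 14) ≠ 13 := fun k => ((mem_filter.1 (hmemT k)).2).2.1
  have hkd : ∀ k, dist (c 13) (c (e k)) = 1 := fun k => ((mem_filter.1 (hmemT k)).2).2.2
  have hinj : ∀ k l, k ≠ l → (e k : Fin 14) ≠ (e l : Fin 14) := fun k l hkl h =>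
    hkl (e.injective (Subtype.val_injective h))
  set D := intruderDist c with hDdef
  have hD1 : 1 ≤ D := hc.one_le_intruderDist
  -- the intruder's direction
  set p := ‖c 13 - c 0‖⁻¹ • (c 13 - c 0) with hpdef
  have hp : ‖p‖ = 1 := hc.norm_dir (by decide)
  set u : Fin 5 → EuclideanSpace ℝ (Fin 3) := fun k => c (e k) - c 0 with hudef
  have hn : ∀ k, ‖u k‖ = 1 := fun k => hc.norm_sub_eq_one (hk0 k) (hk13 k)
  have hlev' : ∀ k, ⟪p, u k⟫_ℝ = D / 2 := by
    intro k
    show ⟪‖c 13 - c 0‖⁻¹ • (c 13 - c 0), c (e k) - c 0⟫_ℝ = D / 2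
    rw [real_inner_comm]
    have hd : dist (c (e k)) (c 13) = 1 := by rw [dist_comm]; exact hkd k
    exact hc.inner_dir_intruder_of_touch (hk0 k) (hk13 k) hd
  have hκ : (5 - √5) / 10 < (D / 2) ^ 2 := by nlinarith [hDlo]
  have hκ1 : (D / 2) ^ 2 < 1 := by nlinarith [hD2, hD1]
  have hlev : ∀ k, ⟪p, u k⟫_ℝ ^ 2 < 1 := fun k => by rw [hlev' k]; exact hκ1
  refine no_five_directions hp u hn hlev ?_
  intro k l hkl
  rw [hlev' k, hlev' l]
  have hin : ⟪u k, u l⟫_ℝ ≤ 1 / 2 :=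
    hc.inner_sub_le_half (hk0 k) (hk13 k) (hk0 l) (hk13 l) (hinj k l hkl)
  rcases half_sub_sq_lt_cos_mul hκ with hkey | hbad
  · have : D / 2 * (D / 2) = (D / 2) ^ 2 := by ring
    rw [this]
    linarith
  · exact absurd hbad (not_le.2 hκ1)

/-- Decimal instance: **for `1.0515 ≤ intruderDist < 2` the intruder touches at most four shell
balls** (`1.0515² = 1.10565 > 2(5 − √5)/5 = 1.10557…`; hole radius `≤ 58.28°`). -/
theorem IsGapConfig.card_intruderContacts_le_four_of_le (hc : IsGapConfig c)
    (hDlo : (1.0515 : ℝ) ≤ intruderDist c) (hD2 : intruderDist c < 2) :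
    (univ.filter fun j : Fin 14 => j ≠ 0 ∧ j ≠ 13 ∧ dist (c 13) (c j) = 1).card ≤ 4 := by
  refine hc.card_intruderContacts_le_four ?_ hD2
  have hs : (2.236 : ℝ) < √5 := by
    rw [Real.lt_sqrt (by norm_num)]; norm_num
  nlinarith [hDlo, hs]

end Summit.Ventures.Crystal3D

end
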